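import Summits.QuantumFields.BalabanUV.T4Continuum.Support.NE9RecordIneq126Above

/-!
# NE9RecordTRBudget — N2 ON THE TR FACE: the leaf-01 budget run on the carriers-of-record END face in the PRINTED CURRENCY
`d_j = torusTreeLen` (`Spine/NE9/CarriersOfRecordFacesTR`, p211088), whose A1-KP producer carries the (1.26) letter
`C = K₀(64,8) = 162⁶⁴/81` (threshold form, `B13DomainGeometryTR.kpInflated_b13`) resp. `C = 2²⁰ + K₀(64,8)·e^{−s′}` (above
threshold, `NE9RecordIneq126Above.kpInflated_b13_above`, FINDING F-ne9leaf05g3-1) — cell `pub-balaban`, T4-DAG §2 node U3 / §6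
row NE9; lineage item «N2-quinquies» of unit `b2b-balaban-t4-ne9-formalise-leaf-01` (gen 4; journal INTENT l.8433; invited by
leaf-05-g3 l.8391 «leaf-01 lineage: N2 budgets on the TR face»).  Series: N2-bis `NE9CubeCurrencyBudget` p208845 ∣ N2-ter
`NE9LinSizeCurrencyBudget(KP)` p209831/p210131, `NE9LinSizeEndBudget` p210458 ∣ N2-quater `NE9LinSizeEndMultiScaleBudget` p211624.

HONEST FRAMING (T4-DAG PAGE 1).  Rung (B)+1 on a FIXED finite four-torus — NOT infinite volume, NOT a mass gap, NOT the Clay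
problem.  NE9 (`T4OutputRate.NE9 ∧ FadingMemory`) is a cell NEW ESTIMATE, NOT PRINTED, and is NOT discharged here («NE9 ⇐ the named
binders»): this module is OUR OWN bookkeeping — real arithmetic on DISPLAYED binder shapes plus one END-level composition BY NAME;
every analytic input stays a displayed binder (the (2.38)-SHAPED majorant is NODE O's, L-S5/L-A2/L-A3 are untouched, N2 stays a
displayed binder (c3)); [II] is quoted for TYPES only (ABSOLUTE RULE: nothing printed in the audited series is asserted);
`FlowStep.BetaPertH`, (B), (B^μ) do not occur; 0 `def`, 0 sorry, no END re-wired (a COROLLARY face beside p211088's).  HONEST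
DEPENDENCY (cell line, verbatim): continuum YM on T⁴ ⇐ BetaPertH ∧ nine spine estimates (0/9 proved); BetaPertH ⇐ (D1) ∧ (D4) ∧
CAP+tail; G-an2-4 gates asym, D1 and NE2/3/4.

THE SHAPES PRICED (verbatim from the tree).  The TR face END-S-vac
`CarriersOfRecordFacesTR.recTR_termSize_ne9_and_fadingMemory_of_couplingTwoPoint_vacSub_sizeInduction` has envelope `B = τ·64·e^{−5σ}`
under `hτ : 0 ≤ τ`, `hσ : 0 ≤ σ`, `hσκ : κ + 1 ≤ σ`, rate letter `ω + 8·lipbar·B·τ̄`, and DISPLAYS the A1-KP conjunct `hK`, whose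
d-currency producers ask `hrate : (64·log 162 [+ s′]) + σ + 64τ ≤ R` and `hsmall : (1+s)·A·e^{5σ+64τ}·C·9 ≤ τ` of the displayed
(2.38)-amplitude `A` and rate `R` (`C` as above; `s = 1` through `twoPointKP_of_kpInflated`).
(P-TR) FADING PRODUCT (§3, necessary direction, pure arithmetic): `hsmall` alone forces `B ≥ 576·(1+s)·A·C·e^{64τ}` (the `e^{±5σ}`
  CANCEL between `hsmall` and `B` — no `e^{κ}` survives, F-ne9leaf01-1 (P) does not recur in this currency), so a fading rate
  `ω + 8·lipbar·B·τ̄ < 1` REQUIRES `4608·(1+s)·C·e^{64τ}·(A·lipbar·τ̄) < 1 − ω`: at `s = 1` the TR face prices fading as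
  `A·lipbar·τ̄ < (1 − ω)·e^{−64τ}/(9216·C)` — threshold form `C = K₀(64,8)`: below `(1 − ω)·1.1·10⁻¹⁴³` (`9216·K₀ > 9.2·10¹⁴²`,
  §4); above threshold at `s′ = 64·log 162`: `C = 2²⁰ + 1/81`, below `(1 − ω)·1.04·10⁻¹⁰` (`9216·(2²⁰ + 1/81) < 9.67·10⁹`, §4).
(R-TR) RATE (§3): `hrate ∧ hσκ ∧ 0 ≤ τ` force `κ ≤ R − (64·log 162 + 1) − s′ − 64τ < R − 326 − s′` (§3 `kappa₀_record_gt`: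
  `325 < 64·log 162`; leaf-05-g3's `kappa₀_record_lt`: `< 326`): ADDITIVE, no division by `2^ν` (F-ne9leaf01-1 (R) repaired in this
  currency, as on E5′), at the price of the threshold letter `κ₀ ≈ 325.6` (+ the room `s′` that buys the small constant).
(S-TR) SUFFICIENCY = §2, THE TR FACE IN PRINT-SHAPED LETTERS (kernel, END-level composition): choosing `σ := κ + 1` and
  `τ⋆ := 18e·A·C·e^{5(κ+1)}` (`C := 2²⁰ + K₀(64,8)·e^{−s′}`) discharges `hK` (through leaf-05-g3's `twoPointKP_record_above` BY NAME),
  `hτ hσ hσκ hpos` and re-letters `hNsucc`, from ONE exponential smallness `hKP : 1152e·A·C·e^{5(κ+1)} ≤ 1` (TYPE of [II] p. 18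
  «Assuming 2E₀ε₁C₁α₄⁻¹α₆⁻¹M^q exp C₂κ₁ exp 5κ ≤ 1») and the ADDITIVE letter-free rate `hrate : 64·log 162 + s′ + κ + 2 ≤ R`; the
  envelope becomes `B⋆ = 1152e·A·C` — EXPONENTIAL-FREE in `κ` (TYPE p. 21 «O(1)C₃ε₁ ≦ ½E₀») — and the rate letter
  `μ⋆ = ω + 9216e·A·C·lipbar·τ̄`, POLYNOMIAL in the table letters; fading `μ⋆ < 1` iff `9216e·C·(A·lipbar·τ̄) < 1 − ω`
  (`fade_printShapedTR_iff`) — within the factor `e` (from `e^{64τ⋆} ≤ e`) of the necessary condition (P-TR).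
CENSUS MEANING (numbers, not adjectives).  On the TR face the only large letter is the (1.26) constant: K₀(64,8) ∈ (10¹³⁹, 10¹⁴⁰) in
the threshold form, `2²⁰ + 1/81 < 1.05·10⁶` above threshold at the cost of `+325.6` rate room; everything else is `9216e < 25052`.
These constants measure the tree's torus counting (`TreeLengthTorusGeometry`: (1.26) with κ₀ = 64·log 162, K₀ = e^{κ₀}/81; the
`d = 0` class count 2²⁰), NOT [II]'s O(1)'s; print's ε₁ «sufficiently small» absorbs any fixed constant, so nothing here is an
objection to any kernel statement or to print — it is the SIZE of the smallness the typed chain currently asks for.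
DISGUISE TEST.  Scalars and one re-instantiation; every displayed analytic binder is a ONE-history statement at the occurring
coupling; the (2.38)-shaped majorant stays a hypothesis SHAPE — not NE9 (two histories) in disguise, not NE5.

References (TYPES only): T. Bałaban, *Renormalization group approach to lattice gauge field theories. II*, Commun. Math. Phys.
**116** (1988) 1–22 [Balaban1988RG2Cluster]: (1.26) p. 8 + remark l. 11–13, (2.27)/(2.30) p. 18 and p. 18 text «exp 5κ ≤ 1»,
Lemma 3 (2.38) p. 20, (2.40)–(2.41) p. 21 and p. 21 text «O(1)C₃ε₁ ≦ ½E₀»; R. Kotecký, D. Preiss, CMP **103** (1986) (1)–(3).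
Summits-side NEW work (LEAN PLACEMENT RULE); imports `Support.NE9RecordIneq126Above` (p212130) only; 0 sorry.
-/

noncomputable section

open scoped BigOperators

namespace Summit.QuantumFields.BalabanUV.T4Continuum.NE9RecordTRBudget

open Literature.MathematicalPhysics.QuantumFieldTheory.Balaban1983to89
open Literature.MathematicalPhysics.QuantumFieldTheory.Balaban1983to89.T4OutputRate
open Literature.MathematicalPhysics.QuantumFieldTheory.Balaban1983to89.T4HistoryLipschitzRecursion
open Literature.MathematicalPhysics.QuantumFieldTheory.Balaban1983to89.T4HistoryLipschitzOuter
open Literature.MathematicalPhysics.QuantumFieldTheory.Balaban1983to89.T4HistoryLipschitzActivity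
open Literature.MathematicalPhysics.QuantumFieldTheory.Balaban1983to89.T4HistoryLipschitzActivity (ClusterGeom)
open Literature.MathematicalPhysics.QuantumFieldTheory.Balaban1983to89.T4HistoryLipschitzSegment
open Literature.MathematicalPhysics.QuantumFieldTheory.Balaban1983to89.B12TreeDecay (K₀ K₀_pos)
open Summit.QuantumFields.BalabanUV.T4Continuum.NE9LastCouplingBridge
open Summit.QuantumFields.BalabanUV.T4Continuum.NE9BridgeSizeInduction
open Summit.QuantumFields.BalabanUV.T4Continuum.B13Carriers (TwoRuns)
open Summit.QuantumFields.BalabanUV.T4Continuum.B13DomainGeometryTR (footprint clusterRep)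
open Summit.QuantumFields.BalabanUV.T4Continuum.NE9.CarriersOfRecordFacesTR
  (recTR_termSize_ne9_and_fadingMemory_of_couplingTwoPoint_vacSub_sizeInduction)
open Summit.QuantumFields.BalabanUV.T4Continuum.NE9RecordIneq126Above
  (twoPointKP_record_above K₀_record_bracket kappa₀_record_lt)

/-! ## §1 The print-shaped scalars of the TR face: `τ⋆ := 18e·A·C·e^{5(κ+1)}`, `σ := κ + 1`, envelope `B⋆ = 1152e·A·C` -/

section Scalars

variable {A C κ s' Rm : ℝ}

/-- `64·τ⋆ = 1152e·A·C·e^{5(κ+1)}` — the print-shaped smallness `hKP` IS `64·τ⋆ ≤ 1`. [folklore] -/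
theorem tauStar_mul_sixtyfour (A C κ : ℝ) :
    18 * Real.exp 1 * A * C * Real.exp ((κ + 1) * 5) * 64 = 1152 * Real.exp 1 * A * C * Real.exp ((κ + 1) * 5) := by
  ring

/-- **THE ENVELOPE IS EXPONENTIAL-FREE**: `τ⋆·64·e^{−5(κ+1)} = 1152e·A·C` (the `e^{5σ}` of `hsmall` and the `e^{−5σ}` of the pin
budget cancel). [folklore] -/
theorem envelope_printShapedTR (A C κ : ℝ) :
    18 * Real.exp 1 * A * C * Real.exp ((κ + 1) * 5) * 64 * Real.exp (-((κ + 1) * 5)) = 1152 * Real.exp 1 * A * C := by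
  have h : Real.exp ((κ + 1) * 5) * Real.exp (-((κ + 1) * 5)) = 1 := by
    rw [← Real.exp_add, add_neg_cancel, Real.exp_zero]
  calc 18 * Real.exp 1 * A * C * Real.exp ((κ + 1) * 5) * 64 * Real.exp (-((κ + 1) * 5))
      = 1152 * Real.exp 1 * A * C * (Real.exp ((κ + 1) * 5) * Real.exp (-((κ + 1) * 5))) := by ring
    _ = 1152 * Real.exp 1 * A * C := by rw [h, mul_one]

/-- **THE PRODUCER's `hsmall` DISCHARGED at `σ := κ + 1`, `τ := τ⋆`, inflation `s = 1` (kernel, real arithmetic)**: for `0 ≤ A`,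
`0 ≤ C` and the print-shaped smallness `1152e·A·C·e^{5(κ+1)} ≤ 1` (i.e. `64τ⋆ ≤ 1`, so `e^{64τ⋆} ≤ e`):
`(1+1)·A·e^{5(κ+1) + 64τ⋆}·C·9 ≤ τ⋆`. [folklore] -/
theorem smallness_of_printShapedTR (hA : 0 ≤ A) (hC : 0 ≤ C)
    (hKP : 1152 * Real.exp 1 * A * C * Real.exp ((κ + 1) * 5) ≤ 1) :
    (1 + 1) * A * Real.exp ((κ + 1) * 5 + 18 * Real.exp 1 * A * C * Real.exp ((κ + 1) * 5) * 64) * C * 9 ≤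
      18 * Real.exp 1 * A * C * Real.exp ((κ + 1) * 5) := by
  have h64 : 18 * Real.exp 1 * A * C * Real.exp ((κ + 1) * 5) * 64 ≤ 1 := by
    rw [tauStar_mul_sixtyfour]; exact hKP
  have hexp : Real.exp ((κ + 1) * 5 + 18 * Real.exp 1 * A * C * Real.exp ((κ + 1) * 5) * 64) ≤
      Real.exp ((κ + 1) * 5) * Real.exp 1 := by
    rw [Real.exp_add]
    exact mul_le_mul_of_nonneg_left (Real.exp_le_exp.2 h64) (Real.exp_pos _).le
  have hAC : 0 ≤ 18 * (A * C) := by positivity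
  calc (1 + 1) * A * Real.exp ((κ + 1) * 5 + 18 * Real.exp 1 * A * C * Real.exp ((κ + 1) * 5) * 64) * C * 9
      = 18 * (A * C) * Real.exp ((κ + 1) * 5 + 18 * Real.exp 1 * A * C * Real.exp ((κ + 1) * 5) * 64) := by ring
    _ ≤ 18 * (A * C) * (Real.exp ((κ + 1) * 5) * Real.exp 1) := mul_le_mul_of_nonneg_left hexp hAC
    _ = 18 * Real.exp 1 * A * C * Real.exp ((κ + 1) * 5) := by ring

/-- **THE PRODUCER's `hrate` DISCHARGED from the ADDITIVE letter-free condition (kernel)**: `64·log 162 + s′ + κ + 2 ≤ R` and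
`64τ⋆ ≤ 1` give `(64·log 162 + s′) + (κ + 1) + 64τ⋆ ≤ R`. [folklore] -/
theorem rate_of_printShapedTR (hKP : 1152 * Real.exp 1 * A * C * Real.exp ((κ + 1) * 5) ≤ 1)
    (hrate : 64 * Real.log 162 + s' + κ + 2 ≤ Rm) :
    (64 * Real.log 162 + s') + (κ + 1) + 18 * Real.exp 1 * A * C * Real.exp ((κ + 1) * 5) * 64 ≤ Rm := by
  have h64 : 18 * Real.exp 1 * A * C * Real.exp ((κ + 1) * 5) * 64 ≤ 1 := by
    rw [tauStar_mul_sixtyfour]; exact hKP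
  linarith

/-- The rate letter of the print-shaped face: `ω + 8·lipbar·B⋆·τ̄ = ω + 9216e·A·C·lipbar·τ̄`. [folklore] -/
theorem rateLetter_printShapedTR (A C lipbar τbar ω : ℝ) :
    ω + 8 * lipbar * (1152 * Real.exp 1 * A * C) * τbar = ω + 9216 * Real.exp 1 * A * C * lipbar * τbar := by
  ring

/-- **FADING OF THE PRINT-SHAPED FACE** (`T4HistoryLipschitzSegment.fade_iff` in these letters): `μ⋆ < 1` iff
`9216e·C·(A·lipbar·τ̄) < 1 − ω` — POLYNOMIAL in the table letters, no `e^{κ}`. [folklore] -/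
theorem fade_printShapedTR_iff (A C lipbar τbar ω : ℝ) :
    ω + 8 * lipbar * (1152 * Real.exp 1 * A * C) * τbar < 1 ↔ 9216 * Real.exp 1 * A * C * lipbar * τbar < 1 - ω := by
  rw [rateLetter_printShapedTR]
  constructor <;> intro h <;> linarith

end Scalars

/-! ## §2 (S-TR) THE TR FACE IN PRINT-SHAPED LETTERS — END-S-vac on the carriers of record with `hK hτ hσ hσκ hpos` DISCHARGED -/

section Face

-- `Pot : Type` (not `Type*`): the producer `twoPointKP_record_above` is stated at universe level 0.
variable {Gg : Type} [GaugeGroup Gg] (R : TwoRuns Gg) {Pot : Type} [NormedAddCommGroup Pot] [NormedSpace ℂ Pot]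

/-- **END-S-vac ON THE CARRIERS OF RECORD, PRINTED CURRENCY, PRINT-SHAPED LETTERS (kernel; bookkeeping).**
`CarriersOfRecordFacesTR.recTR_termSize_ne9_and_fadingMemory_of_couplingTwoPoint_vacSub_sizeInduction` (p211088) at `Bg := R.carriers.BgB`,
`σ := κ + 1`, `τ := τ⋆ = 18e·A·C·e^{5(κ+1)}` with `C := 2²⁰ + K₀(64,8)·e^{−s′}`, its displayed A1-KP binder `hK` PRODUCED by
`NE9RecordIneq126Above.twoPointKP_record_above` (p212130) BY NAME (size clause = `hCup` at `g′ = g`).  GONE: `hK hτ hσ hσκ hpos`;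
DISPLAYED INSTEAD: `hlip` (`0 ≤ lip k`), `htwo` (table two-point), the (2.38)-SHAPED majorant `hn0`/`hm` (hypothesis SHAPE with locator
[II] Lemma 3 (2.38) p. 20 — asserted nowhere), `hA hs' hκ`, the ADDITIVE rate `hrate : 64·log 162 + s′ + κ + 2 ≤ R`, the ONE
exponential smallness `hKP : 1152e·A·C·e^{5(κ+1)} ≤ 1` (TYPE [II] p. 18 «exp 5κ ≤ 1») and `hω : 0 < ω`; `hNsucc` re-lettered with the
exponential-free envelope `B⋆ = 1152e·A·C`.  Conclusion: `TermSize ∧ NE9 ∧ FadingMemory` with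
`ℓ⋆ = 8·clipbar·B⋆ + 8·lipbar·B⋆·qTbar`, `μ⋆ = ω + 8·lipbar·B⋆·τ̄` (= `ω + 9216e·A·C·lipbar·τ̄`, `rateLetter_printShapedTR`).
Every other binder of p211088 VERBATIM, fed positionally. [folklore] -/
theorem recTR_termSize_ne9_and_fadingMemory_printShaped {ι : Type} {E : Functional R.carriers R.carriers.BgB}
    (ρA ρB : (ℕ → ℝ) → R.carriers.BgB → R.carriers.Dom → ℂ)
    {W : Set (ℕ → ℝ)} {Adm : Set (R.carriers.BgB → R.carriers.Dom → ℝ)}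
    {T : ℕ → (ℕ → ℝ) → (R.carriers.BgB → R.carriers.Dom → ℝ) → ι → ℝ}
    {Ψ : ℕ → ℝ → (ι → ℝ) → R.carriers.BgB → R.carriers.Dom → ℝ}
    {act : ℕ → ℝ → R.carriers.BgB → Pot → (ClusterGeom.ofRep (clusterRep R ρA ρB)).P → ℂ} {𝒜 : ℕ → Set Pot}
    {n : ℕ → ℝ → R.carriers.BgB → (ClusterGeom.ofRep (clusterRep R ρA ρB)).P → ℝ} {lip clip : ℕ → ℝ}
    {κ A Rm s' lipbar clipbar qTbar τbar ω : ℝ} {wt : ℕ → ι → ℝ} {τm : ℕ → ℕ → ℝ} {qT p₀ N : ℕ → ℝ}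
    (ρ : ℕ → (ι → ℝ) → Pot) (U₀ : R.carriers.BgB) (explZ : ℕ → R.carriers.BgB → R.carriers.Dom → ℝ)
    -- L-S1 … L-S4 (vacuum-subtracted representation)
    (h0 : ScaleZeroFree E W) (hAdm : AdmissibleTerms E W Adm) (hres : AdmRestrict Adm) (hadd : ChannelAdditive Adm T)
    (hsum : ChannelStepSum Adm T) (hfac : Factorises E W T Ψ)
    (hreprV : ∀ (k : ℕ) (s : ℝ) (P : ι → ℝ) (U : R.carriers.BgB) (X : R.carriers.Dom),
      Ψ k s P U X = ((ClusterGeom.ofRep (clusterRep R ρA ρB)).newTerm act k s U X (ρ k P)).re -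
        ((ClusterGeom.ofRep (clusterRep R ρA ρB)).newTerm act k s U₀ X (ρ k P)).re + explZ k U X)
    -- L-S5 (displayed, c3)
    (hstep : ChannelSizeAtStepNN Adm T κ wt τm)
    (hτm : ∀ k j, j ≤ k → 0 ≤ τm k j ∧ τm k j ≤ τbar * ω ^ (k - j))
    -- L-A1 ⇐ table two-point + (2.38)-SHAPED majorant + ADDITIVE rate + ONE print-shaped smallness
    (hlip : ∀ k, 0 ≤ lip k)
    (htwo : ∀ g ∈ W, ∀ (k : ℕ) (U : R.carriers.BgB) (X : R.carriers.Dom), R.carriers.scale X = k + 1 → ∀ Q ∈ 𝒜 k,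
      ∀ Q' ∈ 𝒜 k, ∀ γ ∈ (ClusterGeom.ofRep (clusterRep R ρA ρB)).vol X,
        ‖act k (g k) U Q γ - act k (g k) U Q' γ‖ ≤ lip k * ‖Q - Q'‖ * n k (g k) U γ)
    (hA : 0 ≤ A) (hs' : 0 ≤ s') (hκ : 0 ≤ κ)
    (hn0 : ∀ (g : ℕ → ℝ) (U : R.carriers.BgB) (Z : R.carriers.Dom),
      0 ≤ n (R.carriers.scale Z - 1) (g (R.carriers.scale Z - 1)) U Z)
    (hm : ∀ g ∈ W, ∀ (U : R.carriers.BgB) (k : ℕ), ∀ Z ∈ R.domAt k,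
      n (R.carriers.scale Z - 1) (g (R.carriers.scale Z - 1)) U Z ≤ A * Real.exp (-(Rm * R.carriers.d Z)))
    (hrate : 64 * Real.log 162 + s' + κ + 2 ≤ Rm)
    (hKP : 1152 * Real.exp 1 * A * (2 ^ 20 + K₀ (4 * 2 ^ 4) (2 * 4) * Real.exp (-s')) * Real.exp ((κ + 1) * 5) ≤ 1)
    (hlipb : ∀ k, lip k ≤ lipbar)
    -- L-A2
    (hclip0 : ∀ k, 0 ≤ clip k)
    (hCup : ∀ g ∈ W, ∀ g' ∈ W, ∀ (k : ℕ) (U : R.carriers.BgB) (X : R.carriers.Dom), R.carriers.scale X = k + 1 →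
      ∀ Q ∈ 𝒜 k, ∀ γ ∈ (ClusterGeom.ofRep (clusterRep R ρA ρB)).vol X,
        ‖act k (g k) U Q γ‖ ≤ n k (g' k) U γ ∧
          ‖act k (g k) U Q γ - act k (g' k) U Q γ‖ ≤ clip k * |g k - g' k| * n k (g' k) U γ)
    (hclipb : ∀ k, clip k ≤ clipbar)
    -- L-A3
    (hqT0 : ∀ k, 0 ≤ qT k)
    (hTcup : ∀ g ∈ W, ∀ g' ∈ W, ∀ (k : ℕ) (y : ι), |T k g (E g) y - T k g' (E g) y| ≤ wt k y * (qT k * |g k - g' k|))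
    (hqTb : ∀ k, qT k ≤ qTbar)
    -- L-R1
    (hρ : ∀ (k : ℕ) (P P' : ι → ℝ) (M : ℝ), (∀ y, |P y - P' y| ≤ wt k y * M) → ‖ρ k P - ρ k P'‖ ≤ M)
    -- (B0), (XZ), (N′), (R′)
    (hexplZ : ∀ (k : ℕ) (U : R.carriers.BgB) (X : R.carriers.Dom), R.carriers.scale X = k + 1 →
      |explZ k U X| ≤ Real.exp (-(κ * R.carriers.d X)) * p₀ k)
    (hbase : ∀ g ∈ W, ∀ (U : R.carriers.BgB) (X : R.carriers.Dom), R.carriers.scale X = 0 →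
      |E g U X| ≤ Real.exp (-(κ * R.carriers.d X)) * N 0)
    (hNsucc : ∀ j, p₀ j + 2 * (1152 * Real.exp 1 * A * (2 ^ 20 + K₀ (4 * 2 ^ 4) (2 * 4) * Real.exp (-s'))) ≤ N (j + 1))
    (hNnn : ∀ j, 0 ≤ N j)
    (hbox : ∀ (k : ℕ) (P : ι → ℝ), (∀ y, |P y| ≤ wt k y * sizeRadius τm N k) → ρ k P ∈ 𝒜 k)
    -- L-N1
    (hτbar : 0 ≤ τbar) (hω : 0 < ω) :
    TermSize E W κ N ∧
      NE9 E W κ (prodModuli (8 * clipbar * (1152 * Real.exp 1 * A * (2 ^ 20 + K₀ (4 * 2 ^ 4) (2 * 4) * Real.exp (-s'))) +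
          8 * lipbar * (1152 * Real.exp 1 * A * (2 ^ 20 + K₀ (4 * 2 ^ 4) (2 * 4) * Real.exp (-s'))) * qTbar)
        fun _ => ω + 8 * lipbar * (1152 * Real.exp 1 * A * (2 ^ 20 + K₀ (4 * 2 ^ 4) (2 * 4) * Real.exp (-s'))) * τbar) ∧
        FadingMemory ((8 * clipbar * (1152 * Real.exp 1 * A * (2 ^ 20 + K₀ (4 * 2 ^ 4) (2 * 4) * Real.exp (-s'))) +
              8 * lipbar * (1152 * Real.exp 1 * A * (2 ^ 20 + K₀ (4 * 2 ^ 4) (2 * 4) * Real.exp (-s'))) * qTbar) /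
            (ω + 8 * lipbar * (1152 * Real.exp 1 * A * (2 ^ 20 + K₀ (4 * 2 ^ 4) (2 * 4) * Real.exp (-s'))) * τbar))
          (ω + 8 * lipbar * (1152 * Real.exp 1 * A * (2 ^ 20 + K₀ (4 * 2 ^ 4) (2 * 4) * Real.exp (-s'))) * τbar)
          (prodModuli (8 * clipbar * (1152 * Real.exp 1 * A * (2 ^ 20 + K₀ (4 * 2 ^ 4) (2 * 4) * Real.exp (-s'))) +
              8 * lipbar * (1152 * Real.exp 1 * A * (2 ^ 20 + K₀ (4 * 2 ^ 4) (2 * 4) * Real.exp (-s'))) * qTbar)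
            fun _ => ω + 8 * lipbar * (1152 * Real.exp 1 * A * (2 ^ 20 + K₀ (4 * 2 ^ 4) (2 * 4) * Real.exp (-s'))) * τbar) := by
  -- the letters: `C` the above-threshold (1.26) constant, `τ⋆` the chosen pin scale, `σ := κ + 1`
  have hC0 : 0 ≤ (2 : ℝ) ^ 20 + K₀ (4 * 2 ^ 4) (2 * 4) * Real.exp (-s') :=
    add_nonneg (by positivity) (mul_nonneg (K₀_pos _ _).le (Real.exp_pos _).le)
  have hτ0 : 0 ≤ 18 * Real.exp 1 * A * (2 ^ 20 + K₀ (4 * 2 ^ 4) (2 * 4) * Real.exp (-s')) * Real.exp ((κ + 1) * 5) :=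
    mul_nonneg (mul_nonneg (by positivity) hC0) (Real.exp_pos _).le
  have hσ0 : 0 ≤ κ + 1 := by linarith
  have hlipbar : 0 ≤ lipbar := (hlip 0).trans (hlipb 0)
  -- the size clause of A1-KP is `hCup` at `g′ = g`
  have hsize : ∀ g ∈ W, ∀ (k : ℕ) (U : R.carriers.BgB) (X : R.carriers.Dom), R.carriers.scale X = k + 1 → ∀ Q ∈ 𝒜 k,
      ∀ γ ∈ (ClusterGeom.ofRep (clusterRep R ρA ρB)).vol X, ‖act k (g k) U Q γ‖ ≤ n k (g k) U γ :=
    fun g hg k U X hX Q hQ γ hγ => (hCup g hg g hg k U X hX Q hQ γ hγ).1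
  -- L-A1's KP conjunct PRODUCED in the printed currency with the above-threshold constant (leaf-05-g3, BY NAME)
  have hK := twoPointKP_record_above R ρA ρB hlip hsize htwo hA hτ0 hσ0 hs' hn0 hm
    (rate_of_printShapedTR hKP hrate) (smallness_of_printShapedTR hA hC0 hKP)
  -- the envelope identity, the re-lettered size step and the positivity of the rate letter
  have henv := envelope_printShapedTR A (2 ^ 20 + K₀ (4 * 2 ^ 4) (2 * 4) * Real.exp (-s')) κ
  have hNsucc' : ∀ j, p₀ j + 2 * (18 * Real.exp 1 * A * (2 ^ 20 + K₀ (4 * 2 ^ 4) (2 * 4) * Real.exp (-s')) *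
      Real.exp ((κ + 1) * 5) * 64 * Real.exp (-((κ + 1) * 5))) ≤ N (j + 1) := by
    intro j; rw [henv]; exact hNsucc j
  have hB0 : 0 ≤ 1152 * Real.exp 1 * A * (2 ^ 20 + K₀ (4 * 2 ^ 4) (2 * 4) * Real.exp (-s')) :=
    mul_nonneg (by positivity) hC0
  have hpos' : 0 < ω + 8 * lipbar * (18 * Real.exp 1 * A * (2 ^ 20 + K₀ (4 * 2 ^ 4) (2 * 4) * Real.exp (-s')) *
      Real.exp ((κ + 1) * 5) * 64 * Real.exp (-((κ + 1) * 5))) * τbar := by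
    rw [henv]
    exact add_pos_of_pos_of_nonneg hω (mul_nonneg (mul_nonneg (mul_nonneg (by norm_num) hlipbar) hB0) hτbar)
  have hEND := recTR_termSize_ne9_and_fadingMemory_of_couplingTwoPoint_vacSub_sizeInduction R ρA ρB ρ U₀ explZ h0 hAdm hres
    hadd hsum hfac hreprV hstep hτm hK hlipb hclip0 hCup hclipb hqT0 hTcup hqTb hτ0 hσ0 (le_refl (κ + 1)) hρ hexplZ hbase
    hNsucc' hNnn hbox hτbar hω.le hpos'
  rw [henv] at hEND
  exact hEND

end Face

/-! ## §3 (P-TR) ∕ (R-TR) THE BUDGET read off the displayed shapes — necessary direction (pure real arithmetic) -/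

section Budget

variable {s A σ τ C lipbar τbar ω κ s' Rm : ℝ}

/-- **(P-TR) THE ENVELOPE IS BOUNDED BELOW BY THE SMALLNESS (kernel).**  From the producer's smallness SHAPE alone,
`(1+s)·A·e^{5σ+64τ}·C·9 ≤ τ` (no sign hypotheses): `576·(1+s)·A·C·e^{64τ} ≤ τ·64·e^{−5σ} = B` — the `e^{5σ}` cancels against the
pin budget's `e^{−5σ}`. [folklore] -/
theorem envelope_lb_of_smallness (hsmall : (1 + s) * A * Real.exp (σ * 5 + τ * 64) * C * 9 ≤ τ) :
    576 * ((1 + s) * A * C) * Real.exp (τ * 64) ≤ τ * 64 * Real.exp (-(σ * 5)) := by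
  have hpos : 0 < 64 * Real.exp (-(σ * 5)) := by positivity
  have h1 : Real.exp (σ * 5 + τ * 64) * Real.exp (-(σ * 5)) = Real.exp (τ * 64) := by
    rw [← Real.exp_add]; ring_nf
  have h := mul_le_mul_of_nonneg_right hsmall hpos.le
  calc 576 * ((1 + s) * A * C) * Real.exp (τ * 64)
      = 576 * ((1 + s) * A * C) * (Real.exp (σ * 5 + τ * 64) * Real.exp (-(σ * 5))) := by rw [h1]
    _ = (1 + s) * A * Real.exp (σ * 5 + τ * 64) * C * 9 * (64 * Real.exp (-(σ * 5))) := by ring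
    _ ≤ τ * (64 * Real.exp (-(σ * 5))) := h
    _ = τ * 64 * Real.exp (-(σ * 5)) := by ring

/-- (P-TR) without the `e^{64τ}`: for `0 ≤ 1 + s`, `0 ≤ A`, `0 ≤ C` the smallness shape gives `576·(1+s)·A·C ≤ B`. [folklore] -/
theorem envelope_lb_of_smallness' (hs : 0 ≤ 1 + s) (hA : 0 ≤ A) (hC : 0 ≤ C)
    (hsmall : (1 + s) * A * Real.exp (σ * 5 + τ * 64) * C * 9 ≤ τ) :
    576 * ((1 + s) * A * C) ≤ τ * 64 * Real.exp (-(σ * 5)) := by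
  have hP : 0 ≤ 576 * ((1 + s) * A * C) := by positivity
  have hτ : 0 ≤ τ := le_trans (by positivity) hsmall
  have h1 : (1 : ℝ) ≤ Real.exp (τ * 64) := Real.one_le_exp (by positivity)
  calc 576 * ((1 + s) * A * C) = 576 * ((1 + s) * A * C) * 1 := (mul_one _).symm
    _ ≤ 576 * ((1 + s) * A * C) * Real.exp (τ * 64) := mul_le_mul_of_nonneg_left h1 hP
    _ ≤ τ * 64 * Real.exp (-(σ * 5)) := envelope_lb_of_smallness hsmall

/-- **(P-TR) FADING ON THE TR FACE IS A SMALLNESS OF `A·lipbar·τ̄` AGAINST THE (1.26) LETTER `C` (kernel, necessary direction).**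
If the END-S-vac rate letter fades, `ω + 8·lipbar·B·τ̄ < 1` with `B = τ·64·e^{−5σ}`, and the producer's smallness shape holds, then
`4608·(1+s)·C·e^{64τ}·(A·lipbar·τ̄) < 1 − ω` (at `s = 1`: `9216·C·e^{64τ}·A·lipbar·τ̄ < 1 − ω`). [folklore] -/
theorem fade_necessary_TR (hlipbar : 0 ≤ lipbar) (hτbar : 0 ≤ τbar)
    (hsmall : (1 + s) * A * Real.exp (σ * 5 + τ * 64) * C * 9 ≤ τ)
    (hfade : ω + 8 * lipbar * (τ * 64 * Real.exp (-(σ * 5))) * τbar < 1) :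
    4608 * ((1 + s) * A * C) * Real.exp (τ * 64) * lipbar * τbar < 1 - ω := by
  have h1 := envelope_lb_of_smallness hsmall
  have h2 : 8 * lipbar * (576 * ((1 + s) * A * C) * Real.exp (τ * 64)) * τbar ≤
      8 * lipbar * (τ * 64 * Real.exp (-(σ * 5))) * τbar :=
    mul_le_mul_of_nonneg_right (mul_le_mul_of_nonneg_left h1 (by positivity)) hτbar
  have h3 : 4608 * ((1 + s) * A * C) * Real.exp (τ * 64) * lipbar * τbar =
      8 * lipbar * (576 * ((1 + s) * A * C) * Real.exp (τ * 64)) * τbar := by ring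
  rw [h3]; linarith

/-- (P-TR) for the END-B rate letter `ω + 4·lipbar·B·τ̄` (constants 4): `2304·(1+s)·C·e^{64τ}·(A·lipbar·τ̄) < 1 − ω`. [folklore] -/
theorem fade_necessary_TR_four (hlipbar : 0 ≤ lipbar) (hτbar : 0 ≤ τbar)
    (hsmall : (1 + s) * A * Real.exp (σ * 5 + τ * 64) * C * 9 ≤ τ)
    (hfade : ω + 4 * lipbar * (τ * 64 * Real.exp (-(σ * 5))) * τbar < 1) :
    2304 * ((1 + s) * A * C) * Real.exp (τ * 64) * lipbar * τbar < 1 - ω := by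
  have h1 := envelope_lb_of_smallness hsmall
  have h2 : 4 * lipbar * (576 * ((1 + s) * A * C) * Real.exp (τ * 64)) * τbar ≤
      4 * lipbar * (τ * 64 * Real.exp (-(σ * 5))) * τbar :=
    mul_le_mul_of_nonneg_right (mul_le_mul_of_nonneg_left h1 (by positivity)) hτbar
  have h3 : 2304 * ((1 + s) * A * C) * Real.exp (τ * 64) * lipbar * τbar =
      4 * lipbar * (576 * ((1 + s) * A * C) * Real.exp (τ * 64)) * τbar := by ring
  rw [h3]; linarith

/-- **THE THRESHOLD RATE FROM BELOW**: `325 < 64·log 162` (so `κ₀ = 64·log 162 ∈ (325, 326)` with leaf-05-g3's `kappa₀_record_lt`),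
from `e^{61} < 162^{12}` (`Real.exp_one_lt_d9`). [folklore] -/
theorem kappa₀_record_gt : 325 < 64 * Real.log 162 := by
  have he : Real.exp 1 < 2.7182818286 := Real.exp_one_lt_d9
  have h61 : Real.exp 61 < (162 : ℝ) ^ 12 := by
    have h := pow_lt_pow_left₀ he (Real.exp_pos 1).le (by norm_num : (61 : ℕ) ≠ 0)
    rw [Real.exp_one_pow 61] at h
    exact h.trans (by norm_num)
  have hlog : (61 : ℝ) < 12 * Real.log 162 := by
    have h := Real.log_lt_log (Real.exp_pos 61) h61
    rw [Real.log_exp, Real.log_pow] at h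
    exact_mod_cast h
  linarith

/-- **(R-TR) THE RATE BUDGET (kernel).**  From the producer's ADDITIVE rate room `(64·log 162 + s′) + σ + 64τ ≤ R`, the face's
`κ + 1 ≤ σ` and `0 ≤ τ`: `κ ≤ R − (64·log 162 + 1) − s′ − 64τ` — additive loss only (no division by `2^ν`), at the price of the
threshold letter. [folklore] -/
theorem rate_budget_TR (hσκ : κ + 1 ≤ σ) (hrate : (64 * Real.log 162 + s') + σ + τ * 64 ≤ Rm) :
    κ ≤ Rm - (64 * Real.log 162 + 1) - s' - τ * 64 := by
  linarith

/-- (R-TR) in numbers: `κ < R − 326 − s′` (for `0 ≤ τ`). [folklore] -/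
theorem rate_budget_TR_num (hσκ : κ + 1 ≤ σ) (hτ : 0 ≤ τ) (hrate : (64 * Real.log 162 + s') + σ + τ * 64 ≤ Rm) :
    κ < Rm - 326 - s' := by
  have h := rate_budget_TR hσκ hrate
  have hκ₀ := kappa₀_record_gt
  nlinarith

/-- (R-TR) for the print-shaped face of §2 (`σ = κ + 1`, room `s′`): its `hrate` reads `κ ≤ R − s′ − (64·log 162 + 2) < R − s′ − 327`;
buying the small constant `2²⁰ + 1/81` with `s′ = 64·log 162` costs `R > κ + 652`. [folklore] -/
theorem rate_budget_printShapedTR (hrate : 64 * Real.log 162 + s' + κ + 2 ≤ Rm) : κ < Rm - s' - 327 := by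
  have hκ₀ := kappa₀_record_gt
  linarith

end Budget

/-! ## §4 The numerals of the fading constant `9216e·C` (second engine: census sheet `NE9RecordTRCensus.md`) -/

/-- `25051 < 9216·e < 25052`. [folklore] -/
theorem fadeConst_bracket : (25051 : ℝ) < 9216 * Real.exp 1 ∧ 9216 * Real.exp 1 < 25052 := by
  have h1 : (2.7182818283 : ℝ) < Real.exp 1 := Real.exp_one_gt_d9
  have h2 : Real.exp 1 < 2.7182818286 := Real.exp_one_lt_d9
  constructor <;> linarith

/-- **THRESHOLD FORM** (`C = K₀(64,8) ∈ (10¹³⁹, 10¹⁴⁰)`, leaf-05-g3's `K₀_record_bracket`): the fading constant `9216e·K₀(64,8)` lies in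
`(10¹⁴³, 10¹⁴⁵)` — fading on the TR face with the threshold producer asks `A·lipbar·τ̄ < (1 − ω)·10⁻¹⁴³`. [folklore] -/
theorem fadeConst_threshold_bracket :
    (10 : ℝ) ^ 143 < 9216 * Real.exp 1 * K₀ (4 * 2 ^ 4) (2 * 4) ∧
      9216 * Real.exp 1 * K₀ (4 * 2 ^ 4) (2 * 4) < (10 : ℝ) ^ 145 := by
  obtain ⟨hlo, hhi⟩ := K₀_record_bracket
  obtain ⟨elo, ehi⟩ := fadeConst_bracket
  have hK0 : 0 ≤ K₀ (4 * 2 ^ 4) (2 * 4) := (K₀_pos _ _).le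
  constructor
  · calc (10 : ℝ) ^ 143 < 25051 * (10 : ℝ) ^ 139 := by norm_num
      _ ≤ 9216 * Real.exp 1 * K₀ (4 * 2 ^ 4) (2 * 4) := mul_le_mul elo.le hlo.le (by positivity) (by linarith)
  · calc 9216 * Real.exp 1 * K₀ (4 * 2 ^ 4) (2 * 4) ≤ 25052 * (10 : ℝ) ^ 140 :=
          mul_le_mul ehi.le hhi.le hK0 (by norm_num)
      _ < (10 : ℝ) ^ 145 := by norm_num

/-- **ABOVE THRESHOLD AT `s′ = 64·log 162`** (`C = 2²⁰ + 1/81`, leaf-05-g3's `K₀_record_mul_exp_at_double`): the fading constant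
`9216e·(2²⁰ + 1/81)` lies in `(2.62·10¹⁰, 2.63·10¹⁰)` — the print-shaped face fades iff `A·lipbar·τ̄ < (1 − ω)·3.81·10⁻¹¹`, a demand
some `4·10¹³³` times weaker than with the threshold constant, bought with `+325.6` of rate room. [folklore] -/
theorem fadeConst_above_at_double_bracket :
    (2.62e10 : ℝ) < 9216 * Real.exp 1 * (2 ^ 20 + 1 / 81) ∧ 9216 * Real.exp 1 * (2 ^ 20 + 1 / 81) < (2.63e10 : ℝ) := by
  obtain ⟨elo, ehi⟩ := fadeConst_bracket
  constructor <;> nlinarith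

/-- Corner (illustration of §2's letters at `ω = 1/13` — the cell's `L = 13` reading of `ω = 1/L` —, `C = 2²⁰ + 1/81`): the print-shaped
fading condition `9216e·C·(A·lipbar·τ̄) < 1 − ω` HOLDS at `A·lipbar·τ̄ = 10⁻¹¹` (`9216e·(2²⁰+1/81)·10⁻¹¹ < 0.263 < 12/13`). [folklore] -/
example : 9216 * Real.exp 1 * (2 ^ 20 + 1 / 81) * (1e-11 : ℝ) < 1 - 1 / 13 := by
  obtain ⟨-, ehi⟩ := fadeConst_above_at_double_bracket
  nlinarith

/-- … and FAILS at `A·lipbar·τ̄ = 10⁻¹⁰` (`9216e·(2²⁰+1/81)·10⁻¹⁰ > 2.62 > 12/13`): the corner's ceiling on `A·lipbar·τ̄` lies in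
`(10⁻¹¹, 10⁻¹⁰)` — precisely `(12/13)/(9216e·(2²⁰+1/81)) ≈ 3.5·10⁻¹¹`. [folklore] -/
example : ¬ (9216 * Real.exp 1 * (2 ^ 20 + 1 / 81) * (1e-10 : ℝ) < 1 - 1 / 13) := by
  obtain ⟨elo, -⟩ := fadeConst_above_at_double_bracket
  exact not_lt.2 (by nlinarith)

end Summit.QuantumFields.BalabanUV.T4Continuum.NE9RecordTRBudget

end
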